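import Summits.ABC.IUTFork.Repair.RHRound4TLinear
import HarnessLib

/-!
# INV-4 cycle 2 (lens `transfer`) — the POOLING-SOUNDNESS CALCULUS: which label-joint × place-joint licences strictly finer than
# the netted display (U) are inside Masser's window, and which of them the solved siblings can reach

abc-iut cell, crux `stmt-ABC-19678` `Summit.ABC.ABC.Theses.IUTThetaPilot.ThetaPartII`; seat abc-iut-inv-4 g0 (planner, cycle 2; KEY
`wake/KEY-abc-iut-inv-4-INV-TRANSFER-HA.md`). Companion to the memo `INV4-CYCLE2-POOLING-CALCULUS.md`; extends the cycle-1 face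
`INV4PerLabelFloor.lean` (singleton pools) to ARBITRARY label pools.

THE OBJECT. A LABEL POOL `G ⊆ {1, …, l⋆}` netted across ALL bad places (reading `(U_𝒫)` for a partition `𝒫` of the labels: free
cross-place and cross-label netting INSIDE each pool, nothing across pools; `𝒫 = {all}` is the netted display (U), `𝒫 = singletons` the
real relaxation of the per-label principal idele (G_j), `𝒫 = initial/final segments` what a Harder–Narasimhan filtration step delivers,
`𝒫 = antipodal pairs {j, l⋆+1−j}` what lattice transference / duality delivers). In the cell currency of record (`Round4TLinear.Variant`,
p545946) the pool is the scheme `pool l G`: print's value law `j ↦ j²`, print's count `j ↦ j+1`, label set `G`, credit `1`.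

WHAT IS TYPED (real/integer arithmetic on the claim-tagged currency; no scheme is asserted to be licensed by anything):
* `slack l j = (j+1)(l+3−3j)` and **`six_le_Estar_pool_iff`**: for a pool of positive demand, `6 ≤ E⋆(pool l G) ↔ 0 ≤ Σ_{j∈G} slack l j`
  — soundness of a pooled licence is an ADDITIVE BUDGET: labels `j ≤ l/3+1` carry credit, labels above carry debt `(j+1)(3j−l−3)`
  (`slack_nonneg_iff`: the cycle-1 singleton window is the one-label case);
* `two_mul_slackSum_Icc` / **`slackSum_full`**: the whole label set has slack `2k(k+2) = (l−1)(l+3)/2` at `l = 2k+1` (print: `E⋆ = 6 + O(1/l)`);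
* **`slack_top`** / `slack_top_neg`: the top label alone has slack `(k+1)(4−k) = −(l+1)(l−9)/4 < 0` for `l ≥ 11`, and
  **`subsidy_floor`**: in ANY sound pool containing the top label the other labels carry credit `≥ (k+1)(k−4)`;
* **`antipodal_rim_unsound`**: the transference pair `{1, l⋆}` is unsound for every `l ≥ 17` (`slack = −k²+7k+6 < 0`, `k ≥ 8`);
* bed instances by `decide` at the beds' extreme prime `l = 107` (`l⋆ = 53`): total `5830`, top `−2646`, final segment `27…53`
  (an HN quotient step) `−15984`, top tercile `36…53` `−20700`, rim pair `−2432`; the INTERLEAVED pools are sound: odd labels `2268`,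
  even labels `3562`, the four classes mod 4 `1066 · 448 · 2496 · 1820` (all `≥ 0`); and at `l = 13`: total `96`, top `−14`, classes
  mod 4 `20 · 32 · 16 · 28`.
* `boundaryO105_107`: the census O-105 block threshold re-derived additively (`11…53` has slack exactly `0` = «E⋆ = 6 EXACTLY», `12…53`
  has `−924`), so this budget and O-105's block ratios are the same functional;
* §4 **`transport2_107` / `transport4_107` / `slackSum_not_transport_invariant`**: the `F_l^{⋊±}` label symmetry `j ↦ ±m·j`
  (`transport l m`) carries the CONSECUTIVE quantile blocks onto the INTERLEAVED residue classes (`·2`: halves ↦ even | odd; `·4`: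
  quarters ↦ classes `0 · 3 · 1 · 2 mod 4`) and flips soundness (top half `−15984` ↦ odd `+2268`; top quarter `−19890` ↦ class 2
  `+2496`): the slack budget is NOT invariant under the label symmetry — it is a property of the integer representatives (value
  exponents `j²`, Frobenius-like), invisible to any symmetry-equivariant (étale-like) mechanism.
READING (prose, decided on the beds by `pool/inv4_pooltest.py`, cells verbatim portraitA.py 2e78e7c6d1d4a1bb, side w; not a theorem of
this file): every interleaved partition mod 2 / 3 / 4 is sound at every prime `5 ≤ l < 1200` AND closes 694/694 bed data (FREY133 ·
HEX79 · FREY482); even singletons close 115/133 · 79/79 · 432/482. So the bed does not discriminate pool structures — the corner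
«label-joint × place-joint, strictly finer than (U)» is POPULATED by sound, data-closing readings — and what is missing is only a MECHANISM:
the solved siblings of the theta-comparison step deliver exactly the UNSOUND members (KS components ↦ singletons; HN sub/quotient steps ↦
segments, the final ones unsound; transference/duality ↦ antipodal pairs, unsound at the rim where the deficit mass sits), and no
permutation of `{1, …, l⋆}` preserves `j ↦ j²`, so no symmetry licenses an interleaved pool. Hence no line and no card (memo §5).

HONESTY: arithmetic on OUR claim-tagged cell currency; a law fitted ≠ a theorem; computed ≠ proved; typed ≠ proved; nothing here asserts
abc proved or refuted; NO side is taken on [IUTchIII] Cor 3.12 / [IUTchIV] Thm 1.10 or on any author (D-0045); the link «`E⋆ < 6` ⇒ refuted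
by Masser» is the cell's READING of the currency (`L1CountFloor.six_le_Estar_iff`, `Literature.Barriers.ABC.SzpiroEpsilonCannotBeDropped`),
not a theorem of this file; a pooled licence is a READING of what the disputed identification would have to license, never a door
(census O-11 / EXP-5: every netting reading has exponent −1 along the height ray).
-/

open Finset

set_option linter.dupNamespace false

namespace Summit.ABC.ABC.Cruxes.ThetaPartII.INV4PoolingSlack

open Summit.ABC.IUTFork.Repair.RH.Round4TLinear

/-! ## §1. The pooled scheme and its soundness budget -/

/-- The POOLED licence on a label set `G`, as a scheme of the cell currency: print's value law `k ↦ k²`, print's count `k ↦ k + 1`,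
label set `G`, credit `μ₀ = 1`, prime `l`. (`pool l {j}` is the cycle-1 `singleLabel l j`.) [folklore] -/
noncomputable def pool (l : ℕ) (G : Finset ℕ) : Variant where
  f := fun k => (k : ℤ) ^ 2
  pk := fun k => (k : ℝ) + 1
  J := G
  μ₀ := 1
  l := l

/-- The SOUNDNESS SLACK of label `j` at the prime `l`: `(j+1)(l+3−3j)` — credit for `j ≤ l/3+1`, debt above. [folklore] -/
def slack (l j : ℕ) : ℤ := ((j : ℤ) + 1) * ((l : ℤ) + 3 - 3 * (j : ℤ))

/-- The slack of a pool: `Σ_{j ∈ G} slack l j`. [folklore] -/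
def slackSum (l : ℕ) (G : Finset ℕ) : ℤ := ∑ j ∈ G, slack l j

theorem S_pool (l : ℕ) (G : Finset ℕ) : S (pool l G) = ∑ j ∈ G, ((j : ℝ) ^ 2 - 1) := by
  simp [S, pool]

theorem countSum_pool (l : ℕ) (G : Finset ℕ) : countSum (pool l G) = ∑ j ∈ G, ((j : ℝ) + 1) := by
  simp [countSum, pool]

/-- The key identity behind the budget: `l·Σ(j+1) − 3·Σ(j²−1) = Σ (j+1)(l+3−3j)`. [folklore] -/
theorem l_mul_countSum_sub (l : ℕ) (G : Finset ℕ) :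
    (l : ℝ) * countSum (pool l G) - 3 * S (pool l G) = (slackSum l G : ℝ) := by
  rw [S_pool, countSum_pool, slackSum]
  push_cast
  rw [Finset.mul_sum, Finset.mul_sum, ← Finset.sum_sub_distrib]
  refine Finset.sum_congr rfl fun j _ => ?_
  simp only [slack]
  push_cast
  ring

/-- **THE POOLING-SOUNDNESS CRITERION.** For a pool of positive demand (`S > 0`, e.g. any pool with a label `≥ 2`):
`6 ≤ E⋆(pool l G) ↔ 0 ≤ Σ_{j∈G} (j+1)(l+3−3j)`. Soundness of a label-joint licence is an additive budget over its labels. [folklore] -/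
theorem six_le_Estar_pool_iff (l : ℕ) (G : Finset ℕ) (hS : 0 < S (pool l G)) :
    6 ≤ Estar (pool l G) ↔ 0 ≤ slackSum l G := by
  have hid := l_mul_countSum_sub l G
  have hl : (pool l G).l = l := rfl
  have hμ : (pool l G).μ₀ = 1 := rfl
  unfold Estar
  rw [hl, hμ, one_mul, le_div_iff₀ hS]
  constructor
  · intro h
    have : (0 : ℝ) ≤ (slackSum l G : ℝ) := by linarith
    exact_mod_cast this
  · intro h
    have : (0 : ℝ) ≤ (slackSum l G : ℝ) := by exact_mod_cast h
    linarith

/-- The one-label case is the cycle-1 window: `0 ≤ slack l j ↔ 3j ≤ l + 3` (i.e. `j ≤ l/3 + 1`). [folklore] -/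
theorem slack_nonneg_iff (l j : ℕ) : 0 ≤ slack l j ↔ 3 * j ≤ l + 3 := by
  unfold slack
  have hj : (0 : ℤ) < (j : ℤ) + 1 := by positivity
  constructor
  · intro h
    have h' : (0 : ℤ) ≤ (l : ℤ) + 3 - 3 * (j : ℤ) := by
      by_contra hc
      push Not at hc
      have : ((j : ℤ) + 1) * ((l : ℤ) + 3 - 3 * (j : ℤ)) < 0 := mul_neg_of_pos_of_neg hj hc
      linarith
    omega
  · intro h
    apply mul_nonneg hj.le
    omega

/-! ## §2. Closed forms: the whole label set, the top label, the subsidy floor, the antipodal rim -/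

/-- `2·Σ_{j=1}^{k} (j+1)(m−3j) = m·k(k+3) − 2k(k+1)(k+2)` for every `m`. [folklore] -/
theorem two_mul_sum_Icc (m k : ℕ) :
    2 * ∑ j ∈ Icc 1 k, ((j : ℤ) + 1) * ((m : ℤ) - 3 * (j : ℤ)) =
      (m : ℤ) * k * (k + 3) - 2 * k * (k + 1) * (k + 2) := by
  induction k with
  | zero => simp
  | succ n ih =>
    rw [Finset.sum_Icc_succ_top (by omega : 1 ≤ n + 1), mul_add, ih]
    push_cast
    ring

/-- **The whole label set `{1,…,l⋆}` at `l = 2k+1` has slack `2k(k+2)`** (`= (l−1)(l+3)/2 > 0`: print's netted display is inside the window,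
`E⋆ = 6 + O(1/l)`). [folklore] -/
theorem slackSum_full (k : ℕ) : slackSum (2 * k + 1) (Icc 1 k) = 2 * k * (k + 2) := by
  have h := two_mul_sum_Icc (2 * k + 4) k
  have hs : slackSum (2 * k + 1) (Icc 1 k) = ∑ j ∈ Icc 1 k, ((j : ℤ) + 1) * (((2 * k + 4 : ℕ) : ℤ) - 3 * (j : ℤ)) := by
    unfold slackSum slack
    refine Finset.sum_congr rfl fun j _ => ?_
    push_cast
    ring
  rw [hs]
  push_cast at h ⊢
  nlinarith [h]

/-- **The top label alone**: `slack (2k+1) k = (k+1)(4−k)` (`= −(l+1)(l−9)/4`). [folklore] -/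
theorem slack_top (k : ℕ) : slack (2 * k + 1) k = ((k : ℤ) + 1) * (4 - (k : ℤ)) := by
  unfold slack
  push_cast
  ring

/-- … negative for every `l ≥ 11` (`k ≥ 5`): no licence that tests the top label on its own — at one place or pooled over all places —
is inside the window. [folklore] -/
theorem slack_top_neg (k : ℕ) (hk : 5 ≤ k) : slack (2 * k + 1) k < 0 := by
  rw [slack_top]
  have hk' : (5 : ℤ) ≤ k := by exact_mod_cast hk
  nlinarith

/-- **THE SUBSIDY FLOOR.** In any SOUND pool containing the top label `k = l⋆` (`l = 2k+1 ≥ 11`), the OTHER labels carry credit at least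
`(k+1)(k−4) = (l+1)(l−9)/4` — an identification object finer than (U) must pool the top label with low labels worth that much. [folklore] -/
theorem subsidy_floor (k : ℕ) (G : Finset ℕ) (hkG : k ∈ G) (hsound : 0 ≤ slackSum (2 * k + 1) G) :
    ((k : ℤ) + 1) * ((k : ℤ) - 4) ≤ slackSum (2 * k + 1) (G.erase k) := by
  have hsplit : slackSum (2 * k + 1) G = slack (2 * k + 1) k + slackSum (2 * k + 1) (G.erase k) := by
    unfold slackSum
    rw [Finset.add_sum_erase _ _ hkG]
  rw [hsplit, slack_top] at hsound
  nlinarith [hsound]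

/-- **THE ANTIPODAL RIM IS UNSOUND.** The transference / duality pair `{1, l⋆}` has slack `−k²+7k+6 < 0` for every `k ≥ 8` (`l ≥ 17`):
pairing label `j` with label `l⋆+1−j` fails the window exactly at the rim, where the deficit mass sits. [folklore] -/
theorem antipodal_rim_unsound (k : ℕ) (hk : 8 ≤ k) : slackSum (2 * k + 1) {1, k} < 0 := by
  unfold slackSum
  rw [Finset.sum_pair (by omega : (1 : ℕ) ≠ k), slack_top]
  unfold slack
  push_cast
  have hk' : (8 : ℤ) ≤ k := by exact_mod_cast hk
  nlinarith

/-! ## §3. Bed instances (`decide`): the beds' extreme prime `l = 107` (`l⋆ = 53`) and `l = 13` (`l⋆ = 6`) -/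

/-- `l = 107`: the whole label set, slack `5830 = 106·110/2`. [folklore] -/
theorem full_107 : slackSum 107 (Icc 1 53) = 5830 := by decide

/-- `l = 107`: the top label alone, `−2646 = −108·98/4`. [folklore] -/
theorem top_107 : slack 107 53 = -2646 := by decide

/-- `l = 107`: the FINAL SEGMENT `27…53` (a Harder–Narasimhan quotient step `E/E₂₆ ↪ F/F₂₆`) is unsound: `−15984`. [folklore] -/
theorem finalSegment_107 : slackSum 107 (Icc 27 53) = -15984 := by decide

/-- `l = 107`: the top tercile `36…53` pooled is unsound: `−20700` (the beds put ≥ 94 % of the optimum residual U2 there). [folklore] -/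
theorem topTercile_107 : slackSum 107 (Icc 36 53) = -20700 := by decide

/-- `l = 107`: the antipodal rim pair `{1, 53}`: `−2432`. [folklore] -/
theorem rim_107 : slackSum 107 {1, 53} = -2432 := by decide

/-- `l = 107`: the ODD labels pooled are sound: `2268 ≥ 0`. [folklore] -/
theorem odd_107 : slackSum 107 ((Icc 1 53).filter fun j => j % 2 = 1) = 2268 := by decide

/-- `l = 107`: the EVEN labels pooled are sound: `3562 ≥ 0`. [folklore] -/
theorem even_107 : slackSum 107 ((Icc 1 53).filter fun j => j % 2 = 0) = 3562 := by decide

/-- `l = 107`: the four classes mod 4 are each sound: `1066 · 448 · 2496 · 1820`. [folklore] -/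
theorem mod4_107 :
    slackSum 107 ((Icc 1 53).filter fun j => j % 4 = 0) = 1066 ∧ slackSum 107 ((Icc 1 53).filter fun j => j % 4 = 1) = 448 ∧
    slackSum 107 ((Icc 1 53).filter fun j => j % 4 = 2) = 2496 ∧ slackSum 107 ((Icc 1 53).filter fun j => j % 4 = 3) = 1820 := by
  decide

/-- `l = 13`: whole set `96`, top label `−14`, classes mod 4 `20 · 32 · 16 · 28` (all sound). [folklore] -/
theorem instances_13 :
    slackSum 13 (Icc 1 6) = 96 ∧ slack 13 6 = -14 ∧
    slackSum 13 ((Icc 1 6).filter fun j => j % 4 = 0) = 20 ∧ slackSum 13 ((Icc 1 6).filter fun j => j % 4 = 1) = 32 ∧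
    slackSum 13 ((Icc 1 6).filter fun j => j % 4 = 2) = 16 ∧ slackSum 13 ((Icc 1 6).filter fun j => j % 4 = 3) = 28 := by
  decide

/-- O-105 cross-check (`l = 107`): the top block `11…53` sits EXACTLY on the floor (slack `0`, i.e. `E⋆ = 6`, census O-105
«[11,53] = 6 EXACTLY»), and `12…53` is below it (`−924 = −slack 107 11`). [folklore] -/
theorem boundaryO105_107 : slackSum 107 (Icc 11 53) = 0 ∧ slackSum 107 (Icc 12 53) = -924 := by decide

/-! ## §4. Soundness is NOT invariant under the `F_l^{⋊±}` label symmetry (`decide` instances at `l = 107`)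

The label symmetries of print act on `j ∈ {1,…,l⋆} = F_l^× / ±` through `j ↦ ±m·j`; on integer representatives this is
`transport l m j = fold l (m j)`. The INTERLEAVED residue classes are the transports of the CONSECUTIVE quantile blocks
(`mod 2`: even labels `= 2·(1…26)`, odd labels `= fold (2·(27…53))`; `mod 4`: the four classes are the `·4`-transports of the four
quarter blocks), and transport flips soundness: the top half `27…53` is unsound (`−15984`, `finalSegment_107`) while its `·2`-image, the
odd labels, is sound (`+2268`); the top quarter `41…53` is unsound (`−19890`) while its `·4`-image, the class `2 mod 4`, is sound (`+2496`).
So the slack budget is a property of the INTEGER representatives (the Frobenius-like value exponents `j²`), invisible to any mechanism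
that is equivariant under the label symmetry (étale-like side); and the value-ordered mechanisms (filtration / procession / pole order /
transference) deliver only blocks and rims (census O-104, O-105, `antipodal_rim_unsound`). -/

/-- Folded representative of `±n (mod l)` in `{0,…,l⋆}`. [folklore] -/
def fold (l n : ℕ) : ℕ := min (n % l) (l - n % l)

/-- The label transport `j ↦ ±m·j` of the `F_l^{⋊±}`-symmetry on integer representatives. [folklore] -/
def transport (l m j : ℕ) : ℕ := fold l (m * j)

/-- `l = 107`, `m = 2`: the bottom half `1…26` transports onto the EVEN labels and the top half `27…53` onto the ODD labels;
the top half is unsound, its transport is sound. [folklore] -/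
theorem transport2_107 :
    (Icc 1 26).image (transport 107 2) = (Icc 1 53).filter (fun j => j % 2 = 0) ∧
    (Icc 27 53).image (transport 107 2) = (Icc 1 53).filter (fun j => j % 2 = 1) ∧
    slackSum 107 (Icc 27 53) = -15984 ∧ slackSum 107 ((Icc 1 53).filter fun j => j % 2 = 1) = 2268 := by
  decide

/-- `l = 107`, `m = 4`: the four quarter blocks `1…13 · 14…26 · 27…40 · 41…53` transport onto the classes `0 · 3 · 1 · 2 (mod 4)`;
the top quarter is unsound (`−19890`), its transport (class `2 mod 4`) is sound (`+2496`, `mod4_107`). [folklore] -/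
theorem transport4_107 :
    (Icc 1 13).image (transport 107 4) = (Icc 1 53).filter (fun j => j % 4 = 0) ∧
    (Icc 14 26).image (transport 107 4) = (Icc 1 53).filter (fun j => j % 4 = 3) ∧
    (Icc 27 40).image (transport 107 4) = (Icc 1 53).filter (fun j => j % 4 = 1) ∧
    (Icc 41 53).image (transport 107 4) = (Icc 1 53).filter (fun j => j % 4 = 2) ∧
    slackSum 107 (Icc 41 53) = -19890 := by
  decide

/-- Hence `slackSum l` is not invariant under the label symmetry: a sound pool and an unsound pool in the same
`F_l^{⋊±}`-orbit of label sets (`l = 107`, the odd labels vs. the top half). [folklore] -/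
theorem slackSum_not_transport_invariant :
    ¬ ∀ G : Finset ℕ, slackSum 107 (G.image (transport 107 2)) = slackSum 107 G := by
  intro h
  obtain ⟨-, himg, htop, hodd⟩ := transport2_107
  have h1 := h (Icc 27 53)
  rw [himg, hodd, htop] at h1
  omega

end Summit.ABC.ABC.Cruxes.ThetaPartII.INV4PoolingSlack
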